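import Mathlib.Algebra.Polynomial.Taylor
import Mathlib.Algebra.Polynomial.HasseDeriv
import Mathlib.Algebra.Polynomial.Derivative
import Mathlib.LinearAlgebra.Vandermonde
import Mathlib.LinearAlgebra.Matrix.Block
import Mathlib.RingTheory.Int.Basic
import Mathlib.Data.Nat.Prime.Factorial
import Mathlib.Algebra.BigOperators.Associated
import Mathlib.Tactic.Positivity
import HarnessLib

/-!
# Ford's systems of polynomials of type `(d,T)` and Lemma 3.1

Topic `Literature/NumberTheory/LFunctions`. Everything here is PROVED; the definitions are the
objects of K. Ford, Proc. LMS 85 (2002), §3 ("Definition" before Lemma 3.1):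

* `FordVK.IsType Ψ d T m` — a `k`-tuple `Ψ = (Ψ_1,…,Ψ_k)` of integer polynomials (indexed by
  `Fin k`, `j ↦ Ψ_{j+1}`) is *of type `(d,T)` with doubling parameter `m`*: `Ψ_j = 0` for `j ≤ d` and
  `Ψ_j` has degree `j − d` with leading coefficient `(j!/(j−d)!) 2^m T` for `j > d`;
* the three operations of §3: translation `Φ_j = ∑_ℓ C(j,ℓ) Ψ_ℓ c^{j−ℓ}` (`FordVK.transl`, again
  of type `(d,T)`), differencing `Υ_j = Φ_j(z+y) − Φ_j(z)` (`j ≥ d+2`, else `0`; `FordVK.diffSys`,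
  of type `(d+1, Ty)`), and doubling `2Ψ` (`FordVK.doubleSys`, type `(d,T)` with `m+1`);
* **Lemma 3.1** (`FordVK.jac_eq`): `J_{k−d}(z;Ψ) := det(Ψ_j'(z_i))_{i ≤ k−d < j ≤ k}
  = (2^mT)^{k−d} ∏_{j=d+1}^{k} j!/(j−d−1)! · ∏_{i<j}(z_j − z_i)` ("by elementary row operations";
  here via Mathlib's factorisation of a matrix of polynomial values through the Vandermonde
  matrix), with the consequences used in Lemma 3.2: non-vanishing at distinct points, and a prime
  `p > k`, `p ∤ T`, not dividing any difference `z_i − z_j`, does not divide `J_{k-d}(z;Ψ)`.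

## References

* K. Ford, Proc. London Math. Soc. (3) 85 (2002), 565–633, §3: Definition of type `(d,T)`,
  Lemma 3.1, and the paragraph following it. [Ford2002]
-/

noncomputable section

open Finset Polynomial Matrix

namespace Literature.NumberTheory.LFunctions
namespace FordVK

/-! ### Systems of type `(d,T)` -/

/-- A system of `k` integer polynomials `Ψ_1,…,Ψ_k`; `Ψ j` is Ford's `Ψ_{j+1}`. [cite: Ford2002, §3] -/
abbrev PSystem (k : ℕ) := Fin k → ℤ[X]

/-- **Type `(d,T)`** with doubling parameter `m`: `Ψ_j = 0` (`j ≤ d`); `deg Ψ_j = j − d` and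
leading coefficient `(j!/(j−d)!)·2^m·T` (`j > d`). [cite: Ford2002, §3 (Definition)] -/
structure IsType {k : ℕ} (Ψ : PSystem k) (d T m : ℕ) : Prop where
  zero : ∀ j : Fin k, j.val + 1 ≤ d → Ψ j = 0
  deg : ∀ j : Fin k, d < j.val + 1 → (Ψ j).natDegree = j.val + 1 - d
  lead : ∀ j : Fin k, d < j.val + 1 →
    (Ψ j).leadingCoeff = (((j.val + 1).descFactorial d : ℕ) : ℤ) * 2 ^ m * T

/-- The initial system `Ψ_j = x^j`, of type `(0,1)`. [cite: Ford2002, §3 ("The argument will begin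
with Ψ_j(z) = z^j (1 ≤ j ≤ k), which is of type (0,1)")] -/
def powSys (k : ℕ) : PSystem k := fun j => X ^ (j.val + 1)

/-- `x^j` is of type `(0,1)`. [cite: Ford2002, §3 ("Ψ_j(z)=z^j … is of type (0,1)")] -/
theorem isType_powSys (k : ℕ) : IsType (powSys k) 0 1 0 where
  zero j hj := by omega
  deg j _ := by simp [powSys]
  lead j _ := by simp [powSys, Nat.descFactorial_zero]

/-- For a system of type `(d,T)` with `T ≠ 0`, the polynomials `Ψ_j`, `j > d`, are nonzero. [folklore] -/
theorem IsType.ne_zero {k : ℕ} {Ψ : PSystem k} {d T m : ℕ} (h : IsType Ψ d T m) (hT : T ≠ 0)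
    (j : Fin k) (hj : d < j.val + 1) : Ψ j ≠ 0 := by
  intro h0
  have hl := h.lead j hj
  rw [h0, leadingCoeff_zero] at hl
  have hdf : 0 < (j.val + 1).descFactorial d := Nat.descFactorial_pos.2 (by omega)
  have hne : (((j.val + 1).descFactorial d : ℕ) : ℤ) * 2 ^ m * T ≠ 0 := by positivity
  exact hne hl.symm

/-! ### Doubling -/

/-- `2Ψ`. [cite: Ford2002, proof of Lemma 3.2 ("2Ψ = (2Ψ_1,…,2Ψ_k) is also of type (d,T)")] -/
def doubleSys {k : ℕ} (Ψ : PSystem k) : PSystem k := fun j => C 2 * Ψ j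

/-- Doubling preserves the type, with `m ↦ m+1`. [cite: Ford2002, proof of Lemma 3.2 ("2Ψ is also of type (d,T) … the reason for the introduction of the parameter m")] -/
theorem IsType.double {k : ℕ} {Ψ : PSystem k} {d T m : ℕ} (h : IsType Ψ d T m) :
    IsType (doubleSys Ψ) d T (m + 1) where
  zero j hj := by simp [doubleSys, h.zero j hj]
  deg j hj := by
    rw [doubleSys, natDegree_C_mul (by norm_num), h.deg j hj]
  lead j hj := by
    rw [doubleSys, leadingCoeff_mul, leadingCoeff_C, h.lead j hj, pow_succ]; ring

/-- Evaluation of `2Ψ`. [folklore] -/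
theorem doubleSys_eval {k : ℕ} (Ψ : PSystem k) (j : Fin k) (x : ℤ) :
    (doubleSys Ψ j).eval x = 2 * (Ψ j).eval x := by
  simp [doubleSys]

/-! ### Translation -/

/-- `Φ_j = ∑_{ℓ ≤ j} C(j,ℓ) c^{j−ℓ} Ψ_ℓ` (Ford's translation; `ℓ = 0` term omitted, it is irrelevant
for differences). [cite: Ford2002, §3 ("for some constant c we will take Φ_j(z) = ∑ C(j,ℓ)Ψ_ℓ(z)c^{j−ℓ}")] -/
def transl {k : ℕ} (c : ℤ) (Ψ : PSystem k) : PSystem k := fun j =>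
  ∑ ℓ ∈ univ.filter (fun ℓ : Fin k => ℓ ≤ j),
    C (((j.val + 1).choose (ℓ.val + 1) : ℤ) * c ^ (j.val - ℓ.val)) * Ψ ℓ

/-- Evaluation of the translated system. [folklore] -/
theorem transl_eval {k : ℕ} (c : ℤ) (Ψ : PSystem k) (j : Fin k) (x : ℤ) :
    (transl c Ψ j).eval x
      = ∑ ℓ ∈ univ.filter (fun ℓ : Fin k => ℓ ≤ j),
          ((j.val + 1).choose (ℓ.val + 1) : ℤ) * c ^ (j.val - ℓ.val) * (Ψ ℓ).eval x := by
  simp [transl, eval_finsetSum]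

/-- **Translation preserves the type `(d,T,m)`.** [cite: Ford2002, §3 ("which is also a system of type (d,T)")] -/
theorem IsType.transl {k : ℕ} {Ψ : PSystem k} {d T m : ℕ} (h : IsType Ψ d T m) (hT : T ≠ 0) (c : ℤ) :
    IsType (transl c Ψ) d T m := by
  classical
  have key : ∀ j : Fin k, d < j.val + 1 →
      (FordVK.transl c Ψ j).natDegree = j.val + 1 - d ∧
        (FordVK.transl c Ψ j).leadingCoeff = (((j.val + 1).descFactorial d : ℕ) : ℤ) * 2 ^ m * T := by
    intro j hj
    -- split off the term `ℓ = j`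
    have hmem : j ∈ univ.filter (fun ℓ : Fin k => ℓ ≤ j) := by simp
    have hsplit : FordVK.transl c Ψ j = Ψ j + ∑ ℓ ∈ (univ.filter (fun ℓ : Fin k => ℓ ≤ j)).erase j,
        C (((j.val + 1).choose (ℓ.val + 1) : ℤ) * c ^ (j.val - ℓ.val)) * Ψ ℓ := by
      rw [FordVK.transl, ← Finset.add_sum_erase _ _ hmem]
      congr 1
      simp
    -- the rest has smaller degree
    have hrest : (∑ ℓ ∈ (univ.filter (fun ℓ : Fin k => ℓ ≤ j)).erase j,
        C (((j.val + 1).choose (ℓ.val + 1) : ℤ) * c ^ (j.val - ℓ.val)) * Ψ ℓ).natDegree < (Ψ j).natDegree := by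
      rw [h.deg j hj]
      refine lt_of_le_of_lt (natDegree_sum_le_of_forall_le _ _ (n := j.val - d) fun ℓ hℓ => ?_) (by omega)
      rw [mem_erase, mem_filter] at hℓ
      have hℓj : ℓ.val < j.val := lt_of_le_of_ne hℓ.2.2 (fun e => hℓ.1 (Fin.ext e))
      by_cases hℓd : ℓ.val + 1 ≤ d
      · rw [h.zero ℓ hℓd, mul_zero, natDegree_zero]; exact Nat.zero_le _
      · refine (natDegree_C_mul_le _ _).trans ?_
        rw [h.deg ℓ (by omega)]; omega
    have hne : Ψ j ≠ 0 := h.ne_zero hT j hj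
    constructor
    · rw [hsplit, natDegree_add_eq_left_of_natDegree_lt hrest, h.deg j hj]
    · rw [hsplit, leadingCoeff_add_of_degree_lt', h.lead j hj]
      exact degree_lt_degree hrest
  refine ⟨fun j hj => ?_, fun j hj => (key j hj).1, fun j hj => (key j hj).2⟩
  -- all terms vanish
  refine Finset.sum_eq_zero fun ℓ hℓ => ?_
  rw [mem_filter] at hℓ
  have : ℓ.val ≤ j.val := hℓ.2
  rw [h.zero ℓ (by omega), mul_zero]

/-! ### Differencing -/

/-- The leading behaviour of `p(X + y) − p(X)`: degree drops by one and the leading coefficient is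
`deg p · lead p · y`. [folklore] -/
theorem natDegree_taylor_sub {p : ℤ[X]} {y : ℤ} (hp : 1 ≤ p.natDegree) (hy : y ≠ 0) (hp0 : p ≠ 0) :
    (taylor y p - p).natDegree = p.natDegree - 1 ∧
      (taylor y p - p).leadingCoeff = p.natDegree * p.leadingCoeff * y := by
  set N := p.natDegree with hN
  have hcoeffN : (taylor y p - p).coeff N = 0 := by
    rw [coeff_sub, taylor_coeff, hN, hasseDeriv_natDegree_eq_C, eval_C]; simp only [leadingCoeff, sub_self]
  have hcoeff_gt : ∀ n, N < n → (taylor y p - p).coeff n = 0 := by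
    intro n hn
    rw [coeff_sub, coeff_eq_zero_of_natDegree_lt (by rwa [natDegree_taylor]), coeff_eq_zero_of_natDegree_lt hn,
      sub_zero]
  have hcoeffN1 : (taylor y p - p).coeff (N - 1) = p.natDegree * p.leadingCoeff * y := by
    rw [coeff_sub, taylor_coeff]
    -- `hasseDeriv (N-1) p` has degree ≤ 1 with coefficients `p_{N-1}` and `N p_N`
    have hdeg : (hasseDeriv (N - 1) p).natDegree ≤ 1 := by
      refine (natDegree_hasseDeriv_le p (N - 1)).trans ?_; omega
    rw [eval_eq_sum_range' (lt_of_le_of_lt hdeg (by norm_num : 1 < 2))]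
    simp only [Finset.sum_range_succ, Finset.sum_range_zero, zero_add, pow_zero, mul_one, pow_one,
      hasseDeriv_coeff]
    have e2 : 1 + (N - 1) = N := by omega
    rw [e2, Nat.choose_self, Nat.cast_one, one_mul]
    have e3 : (N.choose (N - 1) : ℤ) = N := by
      obtain ⟨M, hM⟩ : ∃ M, N = M + 1 := ⟨N - 1, by omega⟩
      rw [hM, Nat.add_sub_cancel, Nat.choose_succ_self_right]
    have hl : p.leadingCoeff = p.coeff N := by rw [leadingCoeff, ← hN]
    rw [e3, hl, ← hN]
    ring
  have hne : (p.natDegree : ℤ) * p.leadingCoeff * y ≠ 0 := by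
    refine mul_ne_zero (mul_ne_zero ?_ (leadingCoeff_ne_zero.2 hp0)) hy
    exact_mod_cast (show p.natDegree ≠ 0 by omega)
  have hle : (taylor y p - p).natDegree ≤ N - 1 := by
    rw [natDegree_le_iff_coeff_eq_zero]
    intro n hn
    rcases lt_or_eq_of_le (show N ≤ n by omega) with h1 | h1
    · exact hcoeff_gt n h1
    · rw [← h1]; exact hcoeffN
  have hdegEq : (taylor y p - p).natDegree = N - 1 :=
    natDegree_eq_of_le_of_coeff_ne_zero hle (by rw [hcoeffN1]; exact hne)
  exact ⟨hdegEq, by rw [leadingCoeff, hdegEq, hcoeffN1]⟩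

/-- `Υ_j = Φ_j(X + y) − Φ_j(X)` for `j ≥ d + 2`, `Υ_j = 0` for `j ≤ d + 1`. [cite: Ford2002, proof of
Lemma 3.3 ("Υ_j(z) = Φ_j(z+hp^r) − Φ_j(z) for j ≥ d+2 and Υ_j(z) ≡ 0 for j ≤ d+1")] -/
def diffSys {k : ℕ} (d : ℕ) (y : ℤ) (Φ : PSystem k) : PSystem k := fun j =>
  if j.val + 1 ≤ d + 1 then 0 else taylor y (Φ j) - Φ j

/-- Evaluation of `Υ_j`, `j ≥ d+2`. [folklore] -/
theorem diffSys_eval {k : ℕ} (d : ℕ) (y : ℤ) (Φ : PSystem k) (j : Fin k) (hj : d + 1 < j.val + 1) (x : ℤ) :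
    (diffSys d y Φ j).eval x = (Φ j).eval (x + y) - (Φ j).eval x := by
  simp [diffSys, show ¬ (j.val + 1 ≤ d + 1) by omega, taylor_eval]

/-- `Υ_j = 0` for `j ≤ d+1`. [folklore] -/
theorem diffSys_of_le {k : ℕ} (d : ℕ) (y : ℤ) (Φ : PSystem k) (j : Fin k) (hj : j.val + 1 ≤ d + 1) :
    diffSys d y Φ j = 0 := by simp [diffSys, hj]

/-- **Differencing raises the type to `(d+1, Ty)`.** [cite: Ford2002, §3 ("which is of type (d+1,yT)") and proof of Lemma 3.3 (last paragraph)] -/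
theorem IsType.diff {k : ℕ} {Φ : PSystem k} {d T m : ℕ} (h : IsType Φ d T m) (hT : T ≠ 0) {y : ℕ}
    (hy : y ≠ 0) : IsType (diffSys d (y : ℤ) Φ) (d + 1) (T * y) m where
  zero j hj := diffSys_of_le d y Φ j hj
  deg j hj := by
    rw [diffSys, if_neg (by omega)]
    have hdeg := h.deg j (by omega)
    have h1 : 1 ≤ (Φ j).natDegree := by rw [hdeg]; omega
    have hy' : (y : ℤ) ≠ 0 := by exact_mod_cast hy
    have := (natDegree_taylor_sub h1 hy' (h.ne_zero hT j (by omega))).1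
    rw [this, hdeg]; omega
  lead j hj := by
    rw [diffSys, if_neg (by omega)]
    have hdeg := h.deg j (by omega)
    have h1 : 1 ≤ (Φ j).natDegree := by rw [hdeg]; omega
    have hy' : (y : ℤ) ≠ 0 := by exact_mod_cast hy
    have := (natDegree_taylor_sub h1 hy' (h.ne_zero hT j (by omega))).2
    rw [this, hdeg, h.lead j (by omega)]
    -- `(j+1-d) * descFactorial (j+1) d = descFactorial (j+1) (d+1)`
    have e : (j.val + 1).descFactorial (d + 1) = (j.val + 1 - d) * (j.val + 1).descFactorial d :=
      Nat.descFactorial_succ _ _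
    rw [e]; push_cast; ring

/-! ### Lemma 3.1: the Jacobian determinant -/

section Jac

variable {k : ℕ}

/-- The index `d + c` (`c < n`, `n + d ≤ k`) as an element of `Fin k`: Ford's column `j = d + 1 + c`. [folklore] -/
def colIdx (d n : ℕ) (hnd : n + d ≤ k) (c : Fin n) : Fin k := ⟨d + c.val, by omega⟩

/-- The Jacobian matrix `(Ψ_j'(z_i))_{i < n, j = d+1, …, d+n}`. [cite: Ford2002, Lemma 3.1] -/
def jacM (Ψ : PSystem k) (d n : ℕ) (hnd : n + d ≤ k) (z : Fin n → ℤ) : Matrix (Fin n) (Fin n) ℤ :=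
  Matrix.of fun i c => (derivative (Ψ (colIdx d n hnd c))).eval (z i)

/-- `J_n(z;Ψ) = det (Ψ_j'(z_i))`. [cite: Ford2002, Lemma 3.1] -/
def jac (Ψ : PSystem k) (d n : ℕ) (hnd : n + d ≤ k) (z : Fin n → ℤ) : ℤ := (jacM Ψ d n hnd z).det

/-- The constant `∏_{c<n} (d+c+1)!/c! · (2^m T)^n` of Lemma 3.1. [folklore] -/
def jacConst (d n T m : ℕ) : ℤ := ∏ c : Fin n, ((((d + c.val + 1).descFactorial (d + 1) : ℕ) : ℤ) * 2 ^ m * T)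

/-- **Ford's Lemma 3.1**: `J_n(z;Ψ) = ∏_c ((d+c+1)!/c!)·2^mT · ∏_{i<j} (z_j − z_i)` for a system of
type `(d,T)`. [cite: Ford2002, Lemma 3.1] -/
theorem jac_eq {Ψ : PSystem k} {d T m : ℕ} (h : IsType Ψ d T m) {n : ℕ} (hnd : n + d ≤ k)
    (z : Fin n → ℤ) :
    jac Ψ d n hnd z = jacConst d n T m * ∏ i : Fin n, ∏ j ∈ Ioi i, (z j - z i) := by
  -- the columns are polynomials of exact degree `c`
  set p : Fin n → ℤ[X] := fun c => derivative (Ψ (colIdx d n hnd c)) with hp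
  have hdegΨ : ∀ c : Fin n, (Ψ (colIdx d n hnd c)).natDegree = c.val + 1 := by
    intro c
    have hc : d < (colIdx d n hnd c).val + 1 := by simp only [colIdx]; omega
    rw [h.deg _ hc]; simp only [colIdx]; omega
  have hdeg : ∀ c : Fin n, (p c).natDegree = c.val := by
    intro c; rw [hp]; dsimp only; rw [natDegree_derivative, hdegΨ]; rfl
  have hlead : ∀ c : Fin n, (p c).coeff c.val = (((d + c.val + 1).descFactorial (d + 1) : ℕ) : ℤ) * 2 ^ m * T := by
    intro c
    have : (p c).coeff c.val = (p c).leadingCoeff := by rw [leadingCoeff, hdeg]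
    rw [this, hp]; dsimp only
    have hc : d < (colIdx d n hnd c).val + 1 := by simp only [colIdx]; omega
    rw [leadingCoeff_derivative, h.lead _ hc, hdegΨ]
    simp only [colIdx]
    have e : (d + c.val + 1).descFactorial (d + 1) = (c.val + 1) * (d + c.val + 1).descFactorial d := by
      rw [Nat.descFactorial_succ]; congr 1; omega
    rw [e]; push_cast; ring
  have hM : jacM Ψ d n hnd z = Matrix.of (fun i c => (p c).eval (z i)) := rfl
  rw [jac, hM, Matrix.eval_matrixOfPolynomials_eq_vandermonde_mul_matrixOfPolynomials z p (fun c => (hdeg c).le),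
    Matrix.det_mul, Matrix.det_vandermonde,
    Matrix.det_of_upperTriangular (Matrix.matrixOfPolynomials_blockTriangular p (fun c => (hdeg c).le))]
  rw [jacConst, mul_comm]
  congr 1
  refine Finset.prod_congr rfl fun c _ => ?_
  rw [Matrix.of_apply, hlead]

/-- `jacConst ≠ 0` (for `T ≠ 0`). [folklore] -/
theorem jacConst_ne_zero (d n T m : ℕ) (hT : T ≠ 0) : jacConst d n T m ≠ 0 := by
  unfold jacConst
  refine Finset.prod_ne_zero_iff.2 fun c _ => ?_
  have : 0 < (d + c.val + 1).descFactorial (d + 1) := Nat.descFactorial_pos.2 (by omega)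
  positivity

/-- **Non-vanishing at distinct points.** [cite: Ford2002, proof of Lemma 3.2 ("J_{k−d}(z;Ψ)J_{k−d}(w;Ψ) ≠ 0")] -/
theorem jac_ne_zero {Ψ : PSystem k} {d T m : ℕ} (h : IsType Ψ d T m) (hT : T ≠ 0) {n : ℕ} (hnd : n + d ≤ k)
    {z : Fin n → ℤ} (hz : Function.Injective z) : jac Ψ d n hnd z ≠ 0 := by
  rw [jac_eq h hnd z]
  refine mul_ne_zero (jacConst_ne_zero d n T m hT) ?_
  refine Finset.prod_ne_zero_iff.2 fun i _ => Finset.prod_ne_zero_iff.2 fun j hj => ?_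
  rw [mem_Ioi] at hj
  exact sub_ne_zero.2 fun e => (ne_of_gt hj) (hz e)

/-- A prime `p > d + n` does not divide `jacConst` unless `p ∣ 2^m T`. [folklore] -/
theorem prime_not_dvd_jacConst {d n T m p : ℕ} (hp : p.Prime) (hpk : d + n < p) (hp2 : p ≠ 2)
    (hpT : ¬ p ∣ T) : ¬ (p : ℤ) ∣ jacConst d n T m := by
  unfold jacConst
  intro hdvd
  have hprime : Prime (p : ℤ) := Nat.prime_iff_prime_int.1 hp
  obtain ⟨c, -, hc⟩ := (Prime.dvd_finsetProd_iff hprime _).1 hdvd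
  rcases hprime.dvd_or_dvd hc with h1 | h1
  · rcases hprime.dvd_or_dvd h1 with h2 | h2
    · -- `p ∣ descFactorial` forces `p ≤ d + c + 1 ≤ d + n`
      have h3 : p ∣ (d + c.val + 1).descFactorial (d + 1) := by exact_mod_cast h2
      have h4 : p ∣ (d + c.val + 1).factorial := by
        have := Nat.factorial_mul_descFactorial (show d + 1 ≤ d + c.val + 1 by omega)
        rw [← this]; exact dvd_mul_of_dvd_right h3 _
      have := (hp.dvd_factorial).1 h4
      omega
    · have : p ∣ 2 ^ m := by exact_mod_cast (Int.natCast_dvd_natCast.1 (by exact_mod_cast h2) : p ∣ 2 ^ m)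
      have := (Nat.prime_dvd_prime_iff_eq hp Nat.prime_two).1 (hp.dvd_of_dvd_pow this)
      exact hp2 this
  · exact hpT (by exact_mod_cast h1)

/-- **A prime avoiding `T` and all differences does not divide `J_n(z;Ψ)`.**
[cite: Ford2002, proof of Lemma 3.2 ("there is some p ∈ 𝒫 which does not divide J(z;Ψ)J(w;Ψ)")] -/
theorem prime_not_dvd_jac {Ψ : PSystem k} {d T m : ℕ} (h : IsType Ψ d T m) {n : ℕ}
    (hnd : n + d ≤ k) {z : Fin n → ℤ} {p : ℕ} (hp : p.Prime) (hpk : k < p) (hp2 : p ≠ 2) (hpT : ¬ p ∣ T)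
    (hz : ∀ i j : Fin n, i ≠ j → ¬ ((p : ℤ) ∣ z i - z j)) : ¬ ((p : ℤ) ∣ jac Ψ d n hnd z) := by
  rw [jac_eq h hnd z]
  have hprime : Prime (p : ℤ) := Nat.prime_iff_prime_int.1 hp
  intro hdvd
  rcases hprime.dvd_or_dvd hdvd with h1 | h1
  · exact prime_not_dvd_jacConst hp (by omega) hp2 hpT h1
  · obtain ⟨i, -, hi⟩ := (Prime.dvd_finsetProd_iff hprime _).1 h1
    obtain ⟨j, hj, hij⟩ := (Prime.dvd_finsetProd_iff hprime _).1 hi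
    rw [mem_Ioi] at hj
    exact hz j i (ne_of_gt hj) hij

/-- Coprimality form: `(J_n(z;Ψ), p) = 1` iff `p` divides no difference (given `p ∤ T`, `p > k`). [folklore] -/
theorem coprime_jac_iff {Ψ : PSystem k} {d T m : ℕ} (h : IsType Ψ d T m) {n : ℕ}
    (hnd : n + d ≤ k) {z : Fin n → ℤ} {p : ℕ} (hp : p.Prime) (hpk : k < p) (hp2 : p ≠ 2) (hpT : ¬ p ∣ T) :
    ¬ ((p : ℤ) ∣ jac Ψ d n hnd z) ↔ ∀ i j : Fin n, i ≠ j → ¬ ((p : ℤ) ∣ z i - z j) := by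
  refine ⟨fun hnd' i j hij hdvd => hnd' ?_, prime_not_dvd_jac h hnd hp hpk hp2 hpT⟩
  rw [jac_eq h hnd z]
  refine dvd_mul_of_dvd_right ?_ _
  rcases lt_or_gt_of_ne hij with hlt | hlt
  · refine dvd_trans ?_ (Finset.dvd_prod_of_mem _ (mem_univ i))
    refine dvd_trans ?_ (Finset.dvd_prod_of_mem _ (mem_Ioi.2 hlt))
    have := hdvd.neg_right; rwa [neg_sub] at this
  · refine dvd_trans ?_ (Finset.dvd_prod_of_mem _ (mem_univ j))
    exact dvd_trans hdvd (Finset.dvd_prod_of_mem _ (mem_Ioi.2 hlt))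

/-- **Translation invariance** of the Jacobian (both systems are of type `(d,T,m)`).
[cite: Ford2002, proof of Lemma 3.2 ("By Lemma 3.1, J_{k−d}(z;Ψ) = J_{k−d}(z;Φ)")] -/
theorem jac_transl {Ψ : PSystem k} {d T m : ℕ} (h : IsType Ψ d T m) (hT : T ≠ 0) (c : ℤ) {n : ℕ}
    (hnd : n + d ≤ k) (z : Fin n → ℤ) : jac (transl c Ψ) d n hnd z = jac Ψ d n hnd z := by
  rw [jac_eq h hnd z, jac_eq (h.transl hT c) hnd z]

end Jac

end FordVK
end Literature.NumberTheory.LFunctions
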